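import Summits.QuantumFields.YangMills.Theorems.BalabanUVNodesN06Row17FromRow19Letters
import Literature.MathematicalPhysics.QuantumFieldTheory.Balaban1983to89.B9Thm311FromEq3105Explicit

/-!
# BalabanUVNodes ∕ N06 ([B9], `Dag.B9_main`) — ROW 17 (`hΔA`: THEOREM 3.11 FOR `Δ_a`) FROM ROW 19's DISPLAYED WALK LETTERS IN dag-n06-c's DIRECTION-LETTER
# SPECIES (R1′-A: `Identities310₂` over `𝔡A ∕ 𝔩A`), BY PRINT'S p. 416 ROAD — dag-n06-j's `N06Row17FromRow19Letters` (p620166) re-keyed, nothing else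

Track A of `YM-PLAN.md` (cell `pub-ymgap`, HUMAN RULING D-0062), node **N06** = [Balaban1985BackgroundPropagators] Thms 3.1–3.15; seat
`pub-ymgap-dag-n06-d` (s2, «knit N06 at the ₁₁ record»), gen 11.  A HELPER for the stage-11 certificate editions ≥ 35 (the R1′-A edition): count-neutral,
`--supports` only.

WHY.  Edition 34 (`…N06AtOpsYNuOfRecordV6EPairNO`, p625759) derives row 17 by dag-n06-j's `row17_of_row19_letters`, which reads rows 19's schema
`Identities310 (𝔬A x) 1 (H x) U` (fields `inv ∕ invT ∕ eq3105 ∕ eq3105T` only).  node00-def-Y's OBS-2 («slice obstruction»: `Identities310.leibL`'s `PL_□ ∘ D` has no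
instance at the record letters) is answered by dag-n06-c's R1′-A road: rows 19 re-typed over `B9Thm310WholeDir.Identities310₂ (𝔬A x) (𝔡A x) (𝔩A x) 1 (H x) U`
(the Laplacian-Leibniz clause over the per-direction letters the certificate pins; `inv ∕ invT ∕ eq3105 ∕ eq3105T` byte-identical).  Edition 35 removes the v1
schema from the certificate, so row 17's road must read the ₂ schema: THIS FILE is n06-j's two theorems with exactly that binder swap —
`posDefTr_deltaAY_of_row19₂` (engine `B9Thm311FromEq3105Explicit.posDefEnd_deltaA_of_identities310₂` = p619203's Theorem-3.11 engine with (3.105)∕(3.105)ᵀ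
displayed) and ★★★ `row17_of_row19_letters₂`; every other binder, every constant (the threshold `M_R`), the conclusion and the proofs VERBATIM (n06-j's
`deltaA_eq_S0coK_of_inv`, `isTransposePair_S0coK`, `posDefTr_deltaAY_of_posDefEnd_S0coK`, `len_le_geo9Y`, n06-i's `rowSum261_geo9Y` BY NAME).
HONEST FRAMING.  Kernel bookkeeping (a schema re-keying); COUNT-NEUTRAL; the local clause `hGsqA` (Cor. 3.6), (3.105) and the factor bounds remain DISPLAYED
hypotheses of the certificate; nothing of [B9] Theorem 3.11 beyond p619203's kernel-checked linear algebra is asserted; N06 NOT discharged.  One finite 𝕋⁴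
programme at fixed `ε` — NOT continuum, NOT OS, NOT the mass gap ∕ Clay.  0 `def`, 0 `sorry`.
-/

noncomputable section

namespace Summit.QuantumFields.YangMills.BalabanUVNodes.N06Row17FromRow19LettersDir

open Literature.MathematicalPhysics.QuantumFieldTheory.Balaban1983to89
open Literature.MathematicalPhysics.QuantumFieldTheory.Balaban1983to89.Node00
open Literature.MathematicalPhysics.QuantumFieldTheory.Balaban1983to89.Node00.OpsYSectDCoords (S0coK cR39_trBasis_pos GcoK_GAY_mul_S0coK)
open Literature.MathematicalPhysics.QuantumFieldTheory.Balaban1983to89.B9CoReadingCoords (XBK GcoK coordOpK)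
open Literature.MathematicalPhysics.QuantumFieldTheory.Balaban1983to89.B9CoReadingCoordsTranspose
open Literature.MathematicalPhysics.QuantumFieldTheory.Balaban1983to89.B9Thm39ReadingCoords (cR39)
open Literature.MathematicalPhysics.QuantumFieldTheory.Balaban1983to89.B9Thm312Whole (PosDefEnd)
open Literature.MathematicalPhysics.QuantumFieldTheory.Balaban1983to89.B9Thm311ReadingCoords (isUnit_of_injective trIP PosDefTr IsSymmTr)
open Literature.MathematicalPhysics.QuantumFieldTheory.Balaban1983to89.B9Thm37Glue (IsTransposePair)
open Literature.MathematicalPhysics.QuantumFieldTheory.Balaban1983to89.B9Thm37GlueTorusCov (isTransposePair_smul)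
open Literature.MathematicalPhysics.QuantumFieldTheory.Balaban1983to89.B9Thm310Whole (Ops310 StaticOK310 Factors389 Identities310 Sizes310)
open Literature.MathematicalPhysics.QuantumFieldTheory.Balaban1983to89.B9Thm310WholeDir (DirLetters310 Identities310₂)
open Literature.MathematicalPhysics.QuantumFieldTheory.Balaban1983to89.B9RWSums346SecondDiff (DirOps310)
open Literature.MathematicalPhysics.QuantumFieldTheory.Balaban1983to89.B9Thm311FromEq3105Explicit (posDefEnd_deltaA_of_identities310₂)
open Literature.MathematicalPhysics.QuantumFieldTheory.Balaban1983to89.B9Thm311PosViaLocalInversesY (deltaAY_parSymY_isSymmTr)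
open Literature.MathematicalPhysics.QuantumFieldTheory.Balaban1983to89.B6KLevelCensusIndexV1 (KIdx)
open Literature.MathematicalPhysics.QuantumFieldTheory.Balaban1983to89.B9Ineq349Whole (LevelGap RowSum261 DistOK)
open Literature.MathematicalPhysics.QuantumFieldTheory.Balaban1983to89.B9PinMembersKLevelV1 (MemberY geo9Y bg9Y)
open Literature.MathematicalPhysics.QuantumFieldTheory.Balaban1983to89.B9GeoLemma21KLevelV1 (levelGap_geo9Y_one rowSum261_geo9Y distOK_geo9Y)
open Summit.QuantumFields.YangMills.BalabanUVNodes.N06SectDUnitsAtPins (injective_of_coordOpK_const injective_of_smul_injective posDefTr_of_posDefEnd_coordOpK_const)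
open Summit.QuantumFields.YangMills.BalabanUVNodes.N06Row17FromRow19Letters
open scoped Matrix
open scoped Matrix.Norms.L2Operator

section Row17

variable {N : ℕ} {d ℓ : ℕ} {hd : 1 ≤ d + 1} {hL : Odd (ℓ + 1) ∧ 1 < ℓ + 1} {b₀ b₁ : ℝ} {Mstar : ℕ}
variable {G : Subgroup (Matrix (Fin N) (Fin N) ℂ)ˣ}

/-- ★★★ **ROW 17's BODY AT ONE MEMBER AND ONE `U` FROM ROW 19's DIRECTION-LETTER SCHEMA (R1′-A), THE (2.61) DATA EXPLICIT** — dag-n06-j's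
`N06Row17FromRow19Letters.posDefTr_deltaAY_of_row19` (p620166) VERBATIM with `hI : Identities310₂ 𝔬 𝔡 𝔩 Rg H U` (dag-n06-c `B9Thm310WholeDir`) over
direction letters `𝔡 : DirOps310 𝔬 Dir`, `𝔩 : DirLetters310 𝔬 Dir` in place of `Identities310 𝔬 Rg H U`, engine `B9Thm311FromEq3105Explicit.posDefEnd_deltaA_of_identities310₂`;
n06-j's text: for `G ≤ U(N)`, `N ≥ 1`, a `G`-valued `U`, walk letters
`𝔬 : Ops310 (geo9Y x) B (XBK (TrIdx N) x.toKIdx) Y ι A` over ANY backgrounds record `B` with `cfg : B.Cfg → CfgY`, with the static data (`StaticOK310`), the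
structure at `U` (`Identities310`: `eq3105 ∕ eq3105T ∕ inv ∕ invT`), the factor majorants (`Factors389 … θ₀ δ₀ U`), the pin of `G` to def-Y's `GAY`, the local
clause on the `Gsq U i`, the (2.61) row sums at the rates `δ₀` (`≤ c`) and `δ₀∕2` (`≤ c′`), `M > 0`, `M ≥ 2·log L∕δ₀` and `N_F·θ₀·(c + L·c′) < 2M`:
`PosDefTr 1 (deltaAY x.toKIdx (parSymY …) (parBY …) (GpY … (parSymY …)) (cfg U))`. [cite: Balaban1985BackgroundPropagators, Thm 3.11 p.416 + (3.105) p.414 + (3.87), (3.89) p.409; Balaban1984PropagatorsII, Lemma 2.1 (2.60)–(2.61) p.234] -/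
theorem posDefTr_deltaAY_of_row19₂ (hN : 0 < N) (hG : G ≤ B7Prop2Explicit.unitaryUnits (Matrix (Fin N) (Fin N) ℂ))
    (x : MemberY d ℓ hd hL b₀ b₁ Mstar) [Fintype (geo9Y x).Site] [DecidableEq (geo9Y x).Site] {B : B9.Backgrounds} (cfg : B.Cfg → CfgY (Matrix (Fin N) (Fin N) ℂ) x.toKIdx)
    {Y ι A Dir : Type} [Fintype ι] [Fintype A] [Fintype Dir] (𝔬 : Ops310 (geo9Y x) B (XBK (TrIdx N) x.toKIdx) Y ι A)
    (𝔡 : DirOps310 𝔬 Dir) (𝔩 : DirLetters310 𝔬 Dir) {Rg : ℝ} {H : Prop} {ρ Nc N' NF Cℓ θ₀ δ₀ c c' : ℝ} {κ : Sizes310} (hθ₀ : 0 ≤ θ₀) (hδ₀ : 0 < δ₀) (hM : 0 < (geo9Y x).M)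
    (hs : StaticOK310 𝔬 ρ Nc N' NF Cℓ κ) (U : B.Cfg) (hU : ∀ μ z, cfg U μ z ∈ G)
    (hI : Identities310₂ 𝔬 𝔡 𝔩 Rg H U) (hF : Factors389 𝔬 Rg H θ₀ δ₀ U)
    (hGpin : 𝔬.G U = GcoK x.toKIdx (trBasis N) B cfg (GAY x.toKIdx (parSymY x.toKIdx) (parBY x.toKIdx) (GpY x.toKIdx (parSymY x.toKIdx))) U)
    (hGsq : ∀ i, IsTransposePair (𝔬.Gsq U i) (𝔬.Gsq U i) ∧ ∀ v, 0 ≤ v ⬝ᵥ 𝔬.Gsq U i v)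
    (hrow : ∀ y : (geo9Y x).Site, ∑ y', Real.exp (-(δ₀ * (geo9Y x).dist y y')) ≤ c)
    (hrow' : ∀ y : (geo9Y x).Site, ∑ y', Real.exp (-(δ₀ / 2 * (geo9Y x).dist y y')) ≤ c')
    (hMlog : 2 * Real.log (geo9Y x).L / δ₀ ≤ (geo9Y x).M) (hbig : NF * θ₀ * (c + (geo9Y x).L * c') < 2 * (geo9Y x).M) :
    PosDefTr (fun _ => (1 : ℝ)) (deltaAY x.toKIdx (parSymY x.toKIdx) (parBY x.toKIdx) (GpY x.toKIdx (parSymY x.toKIdx)) (cfg U)) := by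
  classical
  have hL1 : 1 ≤ (geo9Y x).L := (distOK_geo9Y x).one_le_L
  have hL0 : 0 ≤ (geo9Y x).L := zero_le_one.trans hL1
  -- the letter `Δa` is def-Y's model `S0coK`, hence symmetric
  obtain ⟨-, hΔa⟩ := deltaA_eq_S0coK_of_inv hN x.toKIdx B cfg (parSymY x.toKIdx) (parBY x.toKIdx) (GpY x.toKIdx (parSymY x.toKIdx)) U
    hGpin hI.inv hI.invT
  have hΔat : IsTransposePair (𝔬.Δa U) (𝔬.Δa U) := by
    rw [hΔa]; exact isTransposePair_S0coK x.toKIdx hG B cfg U hU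
  -- the level-gap letter with `Λ = L`, `β = log L ∕ M`, and the row sum at the rate `δ₀ − β ≥ δ₀∕2`
  have hβ : Real.log (geo9Y x).L / (geo9Y x).M ≤ δ₀ / 2 := by
    rw [div_le_iff₀ hM]
    have h1 : 2 * Real.log (geo9Y x).L ≤ (geo9Y x).M * δ₀ := (div_le_iff₀ hδ₀).mp hMlog
    linarith
  have hrow'' : ∀ y : (geo9Y x).Site,
      ∑ y', Real.exp (-((δ₀ - Real.log (geo9Y x).L / (geo9Y x).M) * (geo9Y x).dist y y')) ≤ c' := by
    intro y
    refine (Finset.sum_le_sum fun y' _ => Real.exp_le_exp.mpr ?_).trans (hrow' y)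
    have hd : 0 ≤ (geo9Y x).dist y y' := hs.dnn y y'
    nlinarith
  -- Theorem 3.11 on the letters (file `B9Thm311FromEq3105Schur`), then back to the genuine `Δ_a` through the model
  have hPD := posDefEnd_deltaA_of_identities310₂ 𝔬 𝔡 𝔩 U hs hI hF hθ₀ hM hL0 (len_le_geo9Y x hM) hrow hrow'' hbig hΔat
    (fun i => (hGsq i).1) (fun i => (hGsq i).2)
  rw [hΔa] at hPD
  exact posDefTr_deltaAY_of_posDefEnd_S0coK hN x.toKIdx B cfg _ _ _ U hPD

/-- ★★★ **ROW 17 (`hΔA`) FROM ROW 19's DISPLAYED DIRECTION-LETTER SCHEMA, FOR ALL MEMBERS ABOVE ONE THRESHOLD (R1′-A)** — dag-n06-j's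
`row17_of_row19_letters` (p620166) VERBATIM with the families `𝔡A : ∀ x, DirOps310 (𝔬A x) (QA x)`, `𝔩A : ∀ x, DirLetters310 (𝔬A x) (QA x)` after `𝔬A` and
`hIdA : … → Identities310₂ (𝔬A x) (𝔡A x) (𝔩A x) (Rg x) (H x) U` (the stage-11 certificate's `(h36A ·).2.2` from edition 35 on); n06-j's text: **ROW 17 FROM ROW 19** — print's Theorem 3.11 for `Δ_a` by print's road, the binders shaped
as the certificate's: a backgrounds family `bg x` read into def-Y's configurations by `cfg x` (at the record: `bg := bg9Y … G`, `cfg := fun x U => U`, and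
`hcfgG := fun x c α₀ U hU => hU.1.1` — the (3.35) class of record is `G`-valued by definition), the walk letters `𝔬A x` with their static data `hstA`, the
`Identities310` and `Factors389` components of row 19's `h36A` (regime `M₁`, `a₁`, geometric factor `c35`), the pin `hGcoA` of `(𝔬A x).G` to def-Y's
`GcoK … (GAY …)` (DEFINITIONALLY the edition's right-hand side `GcoK … (lettersYOfRecordV4P …).GA`, `GAv4Y` unfolded), and the NEW local clause `hGsqA` («the
operators G_□(U) are symmetric and positive», p. 416; positive SEMI-definite suffices).  Output: row 17's LITERAL body for every member with `M ≥ M_R`, every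
`α₀ > 0` with `c35·M·α₀ ≤ a₁`, every `U` of the class — `M_R ≥ M₁` absorbs [4] Lemma 2.1 at the geometry of record (n06-i `rowSum261_geo9Y` at the rates `δ₀`,
`δ₀∕2`; `levelGap_geo9Y_one`), `2·log L∕δ₀` and print's «M sufficiently large» `½·N_F·θ₀·(c + L·c′) + 1`.  The symmetry of `Δ_a(U)`, the identification of the
letter `Δa` with def-Y's model, the `L²`-smallness of (3.105)'s `R` and the positivity transfer are THEOREMS (this file and `B9Thm311FromEq3105Schur`).
[cite: Balaban1985BackgroundPropagators, Thm 3.11 p.416 (statement and proof) + (3.105) p.414 + (3.87), (3.89) p.409 + (3.35) p.396; Balaban1984PropagatorsII, Lemma 2.1 (2.60)–(2.61) p.234] -/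
theorem row17_of_row19_letters₂ (hN : 0 < N) (hG : G ≤ B7Prop2Explicit.unitaryUnits (Matrix (Fin N) (Fin N) ℂ))
    [∀ x : MemberY d ℓ hd hL b₀ b₁ Mstar, Fintype (geo9Y x).Site] [∀ x : MemberY d ℓ hd hL b₀ b₁ Mstar, DecidableEq (geo9Y x).Site]
    (bg : MemberY d ℓ hd hL b₀ b₁ Mstar → B9.Backgrounds) (cfg : ∀ x : MemberY d ℓ hd hL b₀ b₁ Mstar, (bg x).Cfg → CfgY (Matrix (Fin N) (Fin N) ℂ) x.toKIdx)
    {c35 : ℝ} (hcfgG : ∀ (x : MemberY d ℓ hd hL b₀ b₁ Mstar) (c α₀ : ℝ) (U : (bg x).Cfg), (bg x).Reg335 c α₀ U → ∀ μ z, cfg x U μ z ∈ G)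
    {Y ι A QA : MemberY d ℓ hd hL b₀ b₁ Mstar → Type} [∀ x, Fintype (ι x)] [∀ x, Fintype (A x)] [∀ x, Fintype (QA x)]
    (𝔬A : ∀ x : MemberY d ℓ hd hL b₀ b₁ Mstar, Ops310 (geo9Y x) (bg x) (XBK (TrIdx N) x.toKIdx) (Y x) (ι x) (A x))
    (𝔡A : ∀ x : MemberY d ℓ hd hL b₀ b₁ Mstar, DirOps310 (𝔬A x) (QA x)) (𝔩A : ∀ x : MemberY d ℓ hd hL b₀ b₁ Mstar, DirLetters310 (𝔬A x) (QA x))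
    {Rg : MemberY d ℓ hd hL b₀ b₁ Mstar → ℝ} {H : MemberY d ℓ hd hL b₀ b₁ Mstar → Prop} {ρ Nc N' NF Cℓ θ₀ δ₀ M₁ a₁ : ℝ}
    {κA : MemberY d ℓ hd hL b₀ b₁ Mstar → Sizes310} (hθ₀ : 0 ≤ θ₀) (hδ₀ : 0 < δ₀)
    (hstA : ∀ x, StaticOK310 (𝔬A x) ρ Nc N' NF Cℓ (κA x))
    (hIdA : ∀ x : MemberY d ℓ hd hL b₀ b₁ Mstar, M₁ ≤ (geo9Y x).M → ∀ α₀ : ℝ, 0 < α₀ → c35 * (geo9Y x).M * α₀ ≤ a₁ →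
      ∀ U : (bg x).Cfg, (bg x).Reg335 c35 α₀ U → Identities310₂ (𝔬A x) (𝔡A x) (𝔩A x) (Rg x) (H x) U)
    (hFacA : ∀ x : MemberY d ℓ hd hL b₀ b₁ Mstar, M₁ ≤ (geo9Y x).M → ∀ α₀ : ℝ, 0 < α₀ → c35 * (geo9Y x).M * α₀ ≤ a₁ →
      ∀ U : (bg x).Cfg, (bg x).Reg335 c35 α₀ U → Factors389 (𝔬A x) (Rg x) (H x) θ₀ δ₀ U)
    (hGcoA : ∀ (x : MemberY d ℓ hd hL b₀ b₁ Mstar) (U : (bg x).Cfg), (𝔬A x).G U =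
      GcoK x.toKIdx (trBasis N) (bg x) (cfg x) (GAY x.toKIdx (parSymY x.toKIdx) (parBY x.toKIdx) (GpY x.toKIdx (parSymY x.toKIdx))) U)
    (hGsqA : ∀ x : MemberY d ℓ hd hL b₀ b₁ Mstar, M₁ ≤ (geo9Y x).M → ∀ α₀ : ℝ, 0 < α₀ → c35 * (geo9Y x).M * α₀ ≤ a₁ →
      ∀ U : (bg x).Cfg, (bg x).Reg335 c35 α₀ U → ∀ i, IsTransposePair ((𝔬A x).Gsq U i) ((𝔬A x).Gsq U i) ∧ ∀ v, 0 ≤ v ⬝ᵥ (𝔬A x).Gsq U i v) :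
    ∃ MR : ℝ, M₁ ≤ MR ∧ ∀ x : MemberY d ℓ hd hL b₀ b₁ Mstar, MR ≤ (geo9Y x).M → ∀ α₀ : ℝ, 0 < α₀ → c35 * (geo9Y x).M * α₀ ≤ a₁ →
      ∀ U : (bg x).Cfg, (bg x).Reg335 c35 α₀ U →
        PosDefTr (fun _ => (1 : ℝ)) (deltaAY x.toKIdx (parSymY x.toKIdx) (parBY x.toKIdx) (GpY x.toKIdx (parSymY x.toKIdx)) (cfg x U)) := by
  classical
  -- [4] (2.61) at the geometry of record at the two rates
  obtain ⟨ML, c, hc⟩ := rowSum261_geo9Y (d := d) (ℓ := ℓ) (hd := hd) (hL := hL) (b₀ := b₀) (b₁ := b₁) (Mstar := Mstar) δ₀ hδ₀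
  obtain ⟨ML', c', hc'⟩ := rowSum261_geo9Y (d := d) (ℓ := ℓ) (hd := hd) (hL := hL) (b₀ := b₀) (b₁ := b₁) (Mstar := Mstar) (δ₀ / 2) (half_pos hδ₀)
  set Lr : ℝ := ((ℓ + 1 : ℕ) : ℝ) with hLr
  refine ⟨max M₁ (max 1 (max ML (max ML' (max (2 * Real.log Lr / δ₀) (NF * θ₀ * (c + Lr * c') / 2 + 1))))), le_max_left _ _, ?_⟩
  intro x hMR α₀ hα₀ ha U hUreg
  have hgeoL : (geo9Y x).L = Lr := B9Ineq347Reading.geo9Y_L x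
  have hM₁ : M₁ ≤ (geo9Y x).M := (le_max_left _ _).trans hMR
  have h1 : (1 : ℝ) ≤ (geo9Y x).M := le_trans (by simp only [le_max_iff, le_refl, true_or, or_true]) hMR
  have hML : ML ≤ (geo9Y x).M := le_trans (by simp only [le_max_iff, le_refl, true_or, or_true]) hMR
  have hML' : ML' ≤ (geo9Y x).M := le_trans (by simp only [le_max_iff, le_refl, true_or, or_true]) hMR
  have hMlog : 2 * Real.log Lr / δ₀ ≤ (geo9Y x).M := le_trans (by simp only [le_max_iff, le_refl, true_or, or_true]) hMR
  have hMbig : NF * θ₀ * (c + Lr * c') / 2 + 1 ≤ (geo9Y x).M := le_trans (by simp only [le_max_iff, le_refl, or_true]) hMR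
  have hM : 0 < (geo9Y x).M := lt_of_lt_of_le one_pos h1
  have hbig : NF * θ₀ * (c + (geo9Y x).L * c') < 2 * (geo9Y x).M := by rw [hgeoL]; linarith
  exact posDefTr_deltaAY_of_row19₂ hN hG x (cfg x) (𝔬A x) (𝔡A x) (𝔩A x) hθ₀ hδ₀ hM (hstA x) U (hcfgG x c35 α₀ U hUreg) (hIdA x hM₁ α₀ hα₀ ha U hUreg)
    (hFacA x hM₁ α₀ hα₀ ha U hUreg) (hGcoA x U) (hGsqA x hM₁ α₀ hα₀ ha U hUreg) (hc x hML) (hc' x hML') (by rw [hgeoL]; exact hMlog) hbig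

end Row17

end Summit.QuantumFields.YangMills.BalabanUVNodes.N06Row17FromRow19LettersDir

end
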